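import Mathlib
import Literature.Analysis.FluidPDE.SuitableWeak
import Literature.Analysis.FluidPDE.SelfSimilarCollapseAnsatz
import Literature.Analysis.FluidPDE.SelfSimilarEulerVorticityExclusionHolds
import Literature.Analysis.FluidPDE.SelfSimilarEulerOutgoing
import Literature.Analysis.FluidPDE.WholeSpaceIBP
import Summits.NavierStokesRegularity.NavierStokesRegularity.Theorems.EulerZoomLiouvillePowerGaugeEulerLiouvilleSelfSimilarGauges
import Summits.NavierStokesRegularity.NavierStokesRegularity.Theorems.EulerZoomLiouvillePowerGaugeEulerLiouvilleIrrotationalTools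
import HarnessLib

/-!
# Rung C1 of the crux `EulerZoomLiouville.PowerGaugeEulerLiouville`: the VORTICITY stratum —
# no self-similar Euler collapse whose vorticity profile decays faster than the natural rate

Route №10 `EulerZoomLiouville` (NavierStokesRegularity), crux E = stmt-NavierStokesRegularity-19832
(`PowerGaugeEulerLiouville`), tenure rung C1 (`Sig.rungC1_selfSimilar`: exactly self-similar
members of Seregin's power-gauged ancient Euler class vanish). This file lands the first in-window
stratum whose lever is the Euler MOMENTUM identity (through the profile VORTICITY equation
`Ω + ((γy + V)·∇)Ω = (Ω·∇)V`, `Ω = curl V`) rather than the local energy inequality — the lever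
critic-2's K3 note (evidence #19/#27 on the crux: "E minus the momentum identity is FALSE") says the
open core needs:

* `profile_const_eq_zero_of_gaugeA` — a CONSTANT profile `V ≡ b` of an exactly self-similar member
  is killed by the `A`-gauge (`∫_{B_L} |b|² = |b|² |B₁| L³ ≤ c L^{1−2ρ}` for all `L`, so `b = 0`);
* `selfSimilar_ae_eq_zero_of_hasCompactSupport_curl` — **stratum A (no decay hypothesis at all)**:
  for EVERY `ρ > 0`, an exactly self-similar member of the class whose profile is a classical
  stationary self-similar Euler profile with COMPACTLY SUPPORTED VORTICITY vanishes a.e.: the tree's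
  `IsSelfSimilarEulerProfile.curl_eq_zero_of_hasCompactSupport` (the `p → 0` weighted `L^p` identity
  for the profile vorticity equation) makes the profile irrotational, and an irrotational
  incompressible profile with the `A`-gauge growth `∫_{B_L}|V|² ≤ c L^{1−2ρ}` vanishes by the
  lead's harmonic Liouville step `ae_eq_zero_of_symm_traceFree_of_growth`;
* `selfSimilar_ae_eq_zero_of_vorticity_memLp` — **stratum B**: for EVERY `ρ > 0`, an exactly
  self-similar member `u(τ) = selfSimilarCollapse (1/(2+ρ)) 0 V τ` of the class (suitable weak
  Euler on the slab, weak gradient, power gauges `a^{2ρ}A + a^{ρ}E + a^{2ρ}D ≤ c`) whose profile is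
  a classical stationary self-similar Euler profile (`IsSelfSimilarEulerProfile (1/(2+ρ)) 0 V P`:
  `V ∈ C²`, `P ∈ C¹`, CIV (3.3)) with strain `½(DV + DVᵀ) → 0` at infinity and vorticity
  `curl V ∈ L^q(ℝ³)` for some `0 < q < 3/(2+ρ)` vanishes a.e. on the slab. Proof: the tree's
  discharged Chae–Shvydkoy Theorem 4.1 (`chaeShvydkoy2013_vorticity_exclusion_holds`, with
  `α = 1+ρ`, `3/(1+α) = 3/(2+ρ)`) makes `V` constant; the `A`-gauge makes the constant zero
  (`profile_energy_growth_of_gaugeA`); a member with vanishing profile vanishes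
  (`selfSimilar_ae_eq_zero_of_profile`).

WHERE IT SITS IN THE WINDOW (`0 < ρ ≤ 1/2`, CS13's `α = 1+ρ ∈ (1, 3/2]`). The natural tail of an
in-window profile is `|V| ~ |y|^{−(1+ρ)}`, `|∇V| ~ |y|^{−(2+ρ)}`, for which `Ω ∈ L^q` iff
`q > 3/(2+ρ)` — JUST outside the hypothesis (CS13 p.10: "the value `p = N/(1+α)` appears naturally
critical"). The stratum therefore excludes every self-similar collapse whose VORTICITY decays
faster than naturally — e.g. `|Ω| ≲ |y|^{−s}` with `s > 2+ρ` (then `Ω ∈ L^q` for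
`3/s < q < 3/(2+ρ)`), in particular compactly supported or integrable-with-room vorticity — while
its VELOCITY may keep an infinite-energy tail (`|V| ~ |y|^{1−s}`, not square integrable for
`s ≤ 5/2`): these members are outside the finite-energy strata (`…FiniteEnergyStrata`, the lead's
profile energy equality F1–F3) and outside the outgoing-flux strata (`…SelfSimilarOutgoing`).

WHAT THIS IS NOT: not NS, not E, not rung C1 whole — profiles with the natural vorticity tail
`|Ω| ~ |y|^{−(2+ρ)}` (the Chae–Shvydkoy window proper) are untouched; the hypothesis `V ∈ C²` makes
this a statement about CLASSICAL profiles.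

## References

* D. Chae, R. Shvydkoy, ARMA 209 (2013) = arXiv:1201.6009, §4 Thm 4.1. [ChaeShvydkoy2013]
-/

noncomputable section

set_option linter.dupNamespace false

open MeasureTheory Set Filter Topology Metric Function
open scoped ENNReal NNReal InnerProductSpace RealInnerProductSpace

namespace Summit.NavierStokesRegularity.NavierStokesRegularity.Theorems.PowerGaugeEulerLiouville

open Literature.Analysis Literature.Analysis.FluidPDE

/-! ## Constant profiles are killed by the `A`-gauge -/

/-- **A constant profile of an exactly self-similar member vanishes** (`ρ > 0`): if
`u(τ) = selfSimilarCollapse (1/(2+ρ)) 0 V τ` for `τ < 0` with `V = b` everywhere and the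
`A`-gauge `a^{2ρ} A(a; 0) ≤ c` holds for all `a > 0`, then `b = 0`. Indeed the profile energy
growth `∫_{B_L} |V|² ≤ c L^{1−2ρ}` (`profile_energy_growth_of_gaugeA`) reads
`|b|² |B₁| L³ ≤ c L^{1−2ρ}`, i.e. `|b|² |B₁| L^{2+2ρ} ≤ c`, for every `L > 0`. [folklore] -/
theorem profile_const_eq_zero_of_gaugeA {ρ : ℝ} (hρ : 0 < ρ)
    {u : ℝ → EuclideanSpace ℝ (Fin 3) → EuclideanSpace ℝ (Fin 3)}
    {V : EuclideanSpace ℝ (Fin 3) → EuclideanSpace ℝ (Fin 3)} {b : EuclideanSpace ℝ (Fin 3)}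
    {c : ℝ≥0} (hV : ∀ y, V y = b)
    (hu : ∀ τ : ℝ, τ < 0 → u τ = selfSimilarCollapse (1 / (2 + ρ)) 0 V τ)
    (hA : ∀ a : ℝ, 0 < a → ENNReal.ofReal (a ^ (2 * ρ)) *
      cknA a (0 : ℝ × EuclideanSpace ℝ (Fin 3)) u ≤ (c : ℝ≥0∞)) :
    b = 0 := by
  by_contra hne
  have hgrowth := profile_energy_growth_of_gaugeA hρ hu hA
  set κ : ℝ≥0∞ := ‖b‖ₑ ^ 2 * volume (ball (0 : EuclideanSpace ℝ (Fin 3)) 1) with hκ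
  clear_value κ
  have hκ0 : κ ≠ 0 := by
    rw [hκ]
    exact mul_ne_zero (pow_ne_zero _ (by simpa using hne)) (measure_ball_pos volume _ one_pos).ne'
  -- for every `L > 0`: `κ · L^{2+2ρ} ≤ c`
  have key : ∀ L : ℝ, 0 < L → κ * ENNReal.ofReal (L ^ (2 + 2 * ρ)) ≤ (c : ℝ≥0∞) := by
    intro L hL
    have h1 := hgrowth L hL
    have hint : ∫⁻ y in ball (0 : EuclideanSpace ℝ (Fin 3)) L, ‖V y‖ₑ ^ 2 =
        κ * ENNReal.ofReal (L ^ 3) := by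
      have h2 : ∫⁻ y in ball (0 : EuclideanSpace ℝ (Fin 3)) L, ‖V y‖ₑ ^ 2 =
          ∫⁻ _ in ball (0 : EuclideanSpace ℝ (Fin 3)) L, ‖b‖ₑ ^ 2 :=
        lintegral_congr_ae (ae_of_all _ fun y => by simp only [hV y])
      rw [h2, lintegral_const, Measure.restrict_apply_univ, Measure.addHaar_ball_of_pos _ _ hL,
        finrank_euclideanSpace_fin, hκ]
      ring
    rw [hint] at h1
    -- multiply by `L^{2ρ−1}`
    have h3 : κ * ENNReal.ofReal (L ^ 3) * ENNReal.ofReal (L ^ (2 * ρ - 1)) ≤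
        (c : ℝ≥0∞) * ENNReal.ofReal (L ^ (1 - 2 * ρ)) * ENNReal.ofReal (L ^ (2 * ρ - 1)) :=
      mul_le_mul' h1 le_rfl
    have e1 : ENNReal.ofReal (L ^ 3) * ENNReal.ofReal (L ^ (2 * ρ - 1)) =
        ENNReal.ofReal (L ^ (2 + 2 * ρ)) := by
      rw [← ENNReal.ofReal_mul (by positivity)]
      congr 1
      rw [show (L ^ 3 : ℝ) = L ^ ((3 : ℕ) : ℝ) from (Real.rpow_natCast L 3).symm,
        ← Real.rpow_add hL]
      norm_num
      ring_nf
    have e2 : ENNReal.ofReal (L ^ (1 - 2 * ρ)) * ENNReal.ofReal (L ^ (2 * ρ - 1)) = 1 := by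
      rw [← ENNReal.ofReal_mul (by positivity), ← Real.rpow_add hL]
      norm_num
    calc κ * ENNReal.ofReal (L ^ (2 + 2 * ρ))
        = κ * ENNReal.ofReal (L ^ 3) * ENNReal.ofReal (L ^ (2 * ρ - 1)) := by rw [mul_assoc, e1]
      _ ≤ (c : ℝ≥0∞) * ENNReal.ofReal (L ^ (1 - 2 * ρ)) * ENNReal.ofReal (L ^ (2 * ρ - 1)) := h3
      _ = (c : ℝ≥0∞) := by rw [mul_assoc, e2, mul_one]
  -- let `L → ∞`
  have hlim : Tendsto (fun L : ℝ => κ * ENNReal.ofReal (L ^ (2 + 2 * ρ))) atTop (𝓝 ⊤) := by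
    have h' := ENNReal.Tendsto.const_mul (a := κ)
      (ENNReal.tendsto_ofReal_atTop.comp (tendsto_rpow_atTop (by linarith : 0 < 2 + 2 * ρ)))
      (Or.inl ENNReal.top_ne_zero)
    rwa [ENNReal.mul_top hκ0] at h'
  obtain ⟨L, hcL, hL⟩ :=
    ((hlim.eventually_const_lt (ENNReal.coe_lt_top (r := c))).and (eventually_gt_atTop 0)).exists
  exact lt_irrefl _ (hcL.trans_le (key L hL))


/-! ## Stratum A: compactly supported vorticity profile -/

/-- If `curl V y = 0` then the Jacobian `DV(y)` is a symmetric map: `⟪DV v, w⟫ = ⟪DV w, v⟫`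
(`‖curl V y‖² = ½ |DV − DVᵀ|²_F`, tree `norm_curl_sq_eq_frobeniusNormSq_spin_holds`). [folklore] -/
theorem inner_fderiv_comm_of_curl_eq_zero
    {V : EuclideanSpace ℝ (Fin 3) → EuclideanSpace ℝ (Fin 3)} {y : EuclideanSpace ℝ (Fin 3)}
    (hV : DifferentiableAt ℝ V y) (hcurl : curl V y = 0) (v w : EuclideanSpace ℝ (Fin 3)) :
    ⟪fderiv ℝ V y v, w⟫ = ⟪fderiv ℝ V y w, v⟫ := by
  have h1 := norm_curl_sq_eq_frobeniusNormSq_spin_holds V y hV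
  rw [hcurl, norm_zero] at h1
  have h2 : frobeniusNormSq (spin V y) = 0 := by
    have : (0 : ℝ) ^ 2 = 0 := by norm_num
    rw [this] at h1
    linarith [frobeniusNormSq_nonneg (spin V y)]
  have h3 : spin V y = 0 := eq_zero_of_frobeniusNormSq_eq_zero h2
  have h3' : fderiv ℝ V y - ContinuousLinearMap.adjoint (fderiv ℝ V y) = 0 := by
    rw [spin] at h3
    convert h3 using 2
  have h4 : ContinuousLinearMap.adjoint (fderiv ℝ V y) = fderiv ℝ V y := (sub_eq_zero.1 h3').symm
  rw [← ContinuousLinearMap.adjoint_inner_right, h4, real_inner_comm]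

/-- **Rung C1, stratum A (every `ρ > 0`): no exactly self-similar Euler collapse in the power-gauged
class with a classical profile whose VORTICITY HAS COMPACT SUPPORT.** Hypotheses: the three clauses of
the route crux `EulerZoomLiouville.PowerGaugeEulerLiouville` for `(u, p, H, c)` at exponent `ρ`;
`u(τ) = selfSimilarCollapse (1/(2+ρ)) 0 V τ` for `τ < 0`; `(V, P)` a classical stationary self-similar
Euler profile (`IsSelfSimilarEulerProfile (1/(2+ρ)) 0 V P`); `curl V` compactly supported. Then
`u = 0` a.e. on the slab. Proof: `curl V ≡ 0` (`IsSelfSimilarEulerProfile.curl_eq_zero_of_hasCompactSupport`,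
the Eulerian `p → 0` identity — the momentum lever); then `DV` is symmetric and trace-free, the
`A`-gauge gives the growth `∫_{B_L}|V|² ≤ c L^{1−2ρ}` (`profile_energy_growth_of_gaugeA`), so
`V = 0` a.e. (`ae_eq_zero_of_symm_traceFree_of_growth`) and the member vanishes
(`selfSimilar_ae_eq_zero_of_profile`). No decay or energy hypothesis on `V`. [cite: ChaeShvydkoy2013, §4 Thm. 4.1 (proof)] -/
theorem selfSimilar_ae_eq_zero_of_hasCompactSupport_curl {ρ : ℝ} (hρ : 0 < ρ)
    (u : ℝ → EuclideanSpace ℝ (Fin 3) → EuclideanSpace ℝ (Fin 3))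
    (p : ℝ → EuclideanSpace ℝ (Fin 3) → ℝ)
    (H : ℝ → EuclideanSpace ℝ (Fin 3) → EuclideanSpace ℝ (Fin 3) →L[ℝ] EuclideanSpace ℝ (Fin 3))
    (c : ℝ≥0) (V : EuclideanSpace ℝ (Fin 3) → EuclideanSpace ℝ (Fin 3))
    (P : EuclideanSpace ℝ (Fin 3) → ℝ)
    (_hsw : IsSuitableWeakSolutionOn (slab (EuclideanSpace ℝ (Fin 3)) (Iio 0) isOpen_Iio) 0 0 u p)
    (hH : HasWeakSpatialGradientOn (slab (EuclideanSpace ℝ (Fin 3)) (Iio 0) isOpen_Iio) u H)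
    (hgauge : ∀ a : ℝ, 0 < a →
      ENNReal.ofReal (a ^ (2 * ρ)) * cknA a (0 : ℝ × EuclideanSpace ℝ (Fin 3)) u +
          ENNReal.ofReal (a ^ ρ) * cknE a (0 : ℝ × EuclideanSpace ℝ (Fin 3)) H +
        ENNReal.ofReal (a ^ (2 * ρ)) * cknD a (0 : ℝ × EuclideanSpace ℝ (Fin 3)) p ≤ (c : ℝ≥0∞))
    (hu : ∀ τ : ℝ, τ < 0 → u τ = selfSimilarCollapse (1 / (2 + ρ)) 0 V τ)
    (hprof : IsSelfSimilarEulerProfile (1 / (2 + ρ)) 0 V P)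
    (hΩc : HasCompactSupport (curl V)) :
    uncurry u =ᵐ[volume.restrict (Iio (0 : ℝ) ×ˢ (univ : Set (EuclideanSpace ℝ (Fin 3))))] 0 := by
  have hγ : 0 < 1 / (2 + ρ) := by positivity
  -- the profile is irrotational
  have hcurl0 : curl V = 0 := hprof.curl_eq_zero_of_hasCompactSupport hγ hΩc
  have hcurl : ∀ y, curl V y = 0 := fun y => congrFun hcurl0 y
  have hV1 : ContDiff ℝ 1 V := hprof.contDiff_velocity.of_le (by norm_num)
  have hVd : Differentiable ℝ V := hprof.differentiable_velocity
  -- its classical gradient is a weak gradient, symmetric and trace-free everywhere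
  have hweak : HasWeakGradient V (fderiv ℝ V) := hasWeakGradient_fderiv_of_contDiff hV1
  have hsym : ∀ᵐ x ∂(volume : Measure (EuclideanSpace ℝ (Fin 3))), ∀ v w : EuclideanSpace ℝ (Fin 3),
      ⟪fderiv ℝ V x v, w⟫ = ⟪fderiv ℝ V x w, v⟫ :=
    ae_of_all _ fun x v w => inner_fderiv_comm_of_curl_eq_zero (hVd x) (hcurl x) v w
  have htr : ∀ᵐ x ∂(volume : Measure (EuclideanSpace ℝ (Fin 3))),
      ∑ j, fderiv ℝ V x (EuclideanSpace.single j (1 : ℝ)) j = 0 := by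
    refine ae_of_all _ fun x => ?_
    have h := hprof.divFree x
    rw [VectorCalculus.divergence, trace_eq_sum_coord] at h
    exact h
  -- the `A`-gauge growth, in the shape `∫_{B_r} ≤ ofReal (c r^{1−2ρ})`
  have hA : ∀ a : ℝ, 0 < a → ENNReal.ofReal (a ^ (2 * ρ)) *
      cknA a (0 : ℝ × EuclideanSpace ℝ (Fin 3)) u ≤ (c : ℝ≥0∞) :=
    fun a ha => le_trans (le_trans le_self_add le_self_add) (hgauge a ha)
  have hgrowth0 := profile_energy_growth_of_gaugeA hρ hu hA
  have hgrowth : ∀ r : ℝ, (0 : ℝ) < r → 0 < r →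
      ∫⁻ x in ball (0 : EuclideanSpace ℝ (Fin 3)) r, ‖V x‖ₑ ^ 2 ≤
        ENNReal.ofReal ((c : ℝ) * r ^ (1 - 2 * ρ)) := by
    intro r _ hr
    have h := hgrowth0 r hr
    rwa [ENNReal.ofReal_mul c.coe_nonneg, ENNReal.ofReal_coe_nnreal]
  have hm : (1 - 2 * ρ : ℝ) < 3 := by linarith
  have hV0 : V =ᵐ[volume] 0 :=
    ae_eq_zero_of_symm_traceFree_of_growth hweak hsym htr hm hgrowth
  -- a member with vanishing profile vanishes
  have hum : AEStronglyMeasurable (uncurry u)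
      (volume.restrict (Iio (0 : ℝ) ×ˢ (univ : Set (EuclideanSpace ℝ (Fin 3))))) := by
    have := hH.locallyIntegrableOn.aestronglyMeasurable
    simpa [slab] using this
  exact selfSimilar_ae_eq_zero_of_profile hum hu hV0

/-! ## Stratum B: vorticity profile in `L^q`, `q < 3/(2+ρ)`, strain vanishing at infinity -/


/-- **Rung C1, stratum B (every `ρ > 0`): no exactly self-similar Euler collapse in the
power-gauged class whose classical profile has strain vanishing at infinity and vorticity in
`L^q(ℝ³)` for some `0 < q < 3/(2+ρ)`.** Hypotheses: the three clauses of the route crux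
`EulerZoomLiouville.PowerGaugeEulerLiouville` for `(u, p, H, c)` at exponent `ρ` (suitable weak
Euler solution on the slab `(−∞,0) × ℝ³` with `ν = 0`, `f = 0`; weak spatial gradient; power gauges
`a^{2ρ}A + a^{ρ}E + a^{2ρ}D ≤ c`); `u` exactly self-similar with profile `V`
(`u(τ) = selfSimilarCollapse (1/(2+ρ)) 0 V τ`, i.e. `u(τ,y) = (−τ)^{−(1+ρ)/(2+ρ)} V((−τ)^{−1/(2+ρ)} y)`);
`(V, P)` a classical stationary self-similar Euler profile with exponent `1/(2+ρ)` and centre `0`;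
strain `½(DV + DVᵀ) → 0` along the cocompact filter; `curl V ∈ L^q`, `0 < q < 3/(2+ρ)`. Then
`u = 0` a.e. on the slab. (Chae–Shvydkoy Thm 4.1, discharged in the tree, gives `V ≡ b`; the
`A`-gauge gives `b = 0`.) [cite: ChaeShvydkoy2013, §4 Thm. 4.1] -/
theorem selfSimilar_ae_eq_zero_of_vorticity_memLp {ρ : ℝ} (hρ : 0 < ρ)
    (u : ℝ → EuclideanSpace ℝ (Fin 3) → EuclideanSpace ℝ (Fin 3))
    (p : ℝ → EuclideanSpace ℝ (Fin 3) → ℝ)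
    (H : ℝ → EuclideanSpace ℝ (Fin 3) → EuclideanSpace ℝ (Fin 3) →L[ℝ] EuclideanSpace ℝ (Fin 3))
    (c : ℝ≥0) (V : EuclideanSpace ℝ (Fin 3) → EuclideanSpace ℝ (Fin 3))
    (P : EuclideanSpace ℝ (Fin 3) → ℝ)
    (_hsw : IsSuitableWeakSolutionOn (slab (EuclideanSpace ℝ (Fin 3)) (Iio 0) isOpen_Iio) 0 0 u p)
    (hH : HasWeakSpatialGradientOn (slab (EuclideanSpace ℝ (Fin 3)) (Iio 0) isOpen_Iio) u H)
    (hgauge : ∀ a : ℝ, 0 < a →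
      ENNReal.ofReal (a ^ (2 * ρ)) * cknA a (0 : ℝ × EuclideanSpace ℝ (Fin 3)) u +
          ENNReal.ofReal (a ^ ρ) * cknE a (0 : ℝ × EuclideanSpace ℝ (Fin 3)) H +
        ENNReal.ofReal (a ^ (2 * ρ)) * cknD a (0 : ℝ × EuclideanSpace ℝ (Fin 3)) p ≤ (c : ℝ≥0∞))
    (hu : ∀ τ : ℝ, τ < 0 → u τ = selfSimilarCollapse (1 / (2 + ρ)) 0 V τ)
    (hprof : IsSelfSimilarEulerProfile (1 / (2 + ρ)) 0 V P)
    (hstrain : Tendsto (fun y => ‖(1 / 2 : ℝ) •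
        (fderiv ℝ V y + ContinuousLinearMap.adjoint (fderiv ℝ V y))‖)
      (cocompact (EuclideanSpace ℝ (Fin 3))) (𝓝 0))
    {q : ℝ} (hq : 0 < q) (hq3 : q < 3 / (2 + ρ))
    (hΩq : MemLp (curl V) (ENNReal.ofReal q) volume) :
    uncurry u =ᵐ[volume.restrict (Iio (0 : ℝ) ×ˢ (univ : Set (EuclideanSpace ℝ (Fin 3))))] 0 := by
  -- Chae–Shvydkoy Thm 4.1 with `α = 1 + ρ`: the profile is constant
  have hα : (-1 : ℝ) < 1 + ρ := by linarith
  have hprof' : IsSelfSimilarEulerProfile (1 / ((1 + ρ) + 1)) 0 V P := by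
    rw [show (1 + ρ) + 1 = 2 + ρ by ring]; exact hprof
  have hq3' : q < 3 / (1 + (1 + ρ)) := by rw [show 1 + (1 + ρ) = 2 + ρ by ring]; exact hq3
  obtain ⟨b, hb⟩ := chaeShvydkoy2013_vorticity_exclusion_holds (1 + ρ) q V P hα hq hq3' hprof'
    hstrain hΩq
  -- the `A`-gauge kills the constant
  have hA : ∀ a : ℝ, 0 < a → ENNReal.ofReal (a ^ (2 * ρ)) *
      cknA a (0 : ℝ × EuclideanSpace ℝ (Fin 3)) u ≤ (c : ℝ≥0∞) :=
    fun a ha => le_trans (le_trans le_self_add le_self_add) (hgauge a ha)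
  have hb0 : b = 0 := profile_const_eq_zero_of_gaugeA hρ hb hu hA
  have hV0 : V =ᵐ[volume] 0 := ae_of_all _ fun y => by rw [hb y, hb0]; rfl
  -- a member with vanishing profile vanishes
  have hum : AEStronglyMeasurable (uncurry u)
      (volume.restrict (Iio (0 : ℝ) ×ˢ (univ : Set (EuclideanSpace ℝ (Fin 3))))) := by
    have := hH.locallyIntegrableOn.aestronglyMeasurable
    simpa [slab] using this
  exact selfSimilar_ae_eq_zero_of_profile hum hu hV0

/-! ## Stratum B in Constantin–Ignatova–Vicol's far-field class, and the outgoing-nodal stratum -/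

/-- A field obeying CIV's far-field bounds (3.8) with a positive exponent has strain tending to zero at
infinity: `‖½(DV + DVᵀ)‖ ≤ ‖DV‖ ≤ C ⟨y⟩^{−1/γ} → 0`. [cite: ConstantinIgnatovaVicol2026Putative, §3.1.3 eq. (3.8)] -/
theorem tendsto_strain_of_hasSelfSimilarFarFieldWith {γ C : ℝ} (hγ : 0 < γ)
    {V : EuclideanSpace ℝ (Fin 3) → EuclideanSpace ℝ (Fin 3)}
    (hfar : HasSelfSimilarFarFieldWith γ 0 C V) :
    Tendsto (fun y => ‖(1 / 2 : ℝ) •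
        (fderiv ℝ V y + ContinuousLinearMap.adjoint (fderiv ℝ V y))‖)
      (cocompact (EuclideanSpace ℝ (Fin 3))) (𝓝 0) := by
  -- `‖½(L + L†)‖ ≤ ‖L‖`
  have hstrain : ∀ y, ‖(1 / 2 : ℝ) • (fderiv ℝ V y + ContinuousLinearMap.adjoint (fderiv ℝ V y))‖ ≤
      ‖fderiv ℝ V y‖ := by
    intro y
    rw [norm_smul, Real.norm_of_nonneg (by norm_num : (0 : ℝ) ≤ 1 / 2)]
    have h1 := norm_add_le (fderiv ℝ V y) (ContinuousLinearMap.adjoint (fderiv ℝ V y))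
    have h2 : ‖ContinuousLinearMap.adjoint (fderiv ℝ V y)‖ = ‖fderiv ℝ V y‖ :=
      LinearIsometryEquiv.norm_map _ _
    linarith
  -- the majorant `C (1 + ‖y‖²)^{−1/(2γ)} → 0` along the cocompact filter
  have hexp : 0 < 1 / (2 * γ) := by positivity
  have hmaj : Tendsto (fun y : EuclideanSpace ℝ (Fin 3) => C * (1 + ‖y - 0‖ ^ 2) ^ (-(1 / (2 * γ))))
      (cocompact (EuclideanSpace ℝ (Fin 3))) (𝓝 0) := by
    have h1 : Tendsto (fun y : EuclideanSpace ℝ (Fin 3) => 1 + ‖y - 0‖ ^ 2)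
        (cocompact (EuclideanSpace ℝ (Fin 3))) atTop := by
      have hn : Tendsto (fun y : EuclideanSpace ℝ (Fin 3) => ‖y‖) (cocompact _) atTop :=
        tendsto_norm_cocompact_atTop
      have h2 : Tendsto (fun y : EuclideanSpace ℝ (Fin 3) => ‖y‖ ^ 2) (cocompact _) atTop :=
        (tendsto_pow_atTop two_ne_zero).comp hn
      simpa using tendsto_atTop_add_const_left _ (1 : ℝ) h2
    have h3 := (tendsto_rpow_neg_atTop hexp).comp h1
    have h4 := h3.const_mul C
    rw [mul_zero] at h4
    refine h4.congr fun y => ?_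
    simp only [Function.comp_apply]
  refine squeeze_zero' (Eventually.of_forall fun y => norm_nonneg _)
    (Eventually.of_forall fun y => (hstrain y).trans (hfar.norm_fderiv_le y)) hmaj

/-- **Stratum B in the far-field class (every `ρ > 0`)**: an exactly self-similar class member whose
classical profile obeys Constantin–Ignatova–Vicol's far-field bounds (3.8) with the class exponent
`γ = 1/(2+ρ)` and whose vorticity profile lies in `L^q(ℝ³)` for some `0 < q < 3/(2+ρ)` vanishes
a.e. — the far-field bounds deliver the strain decay of `selfSimilar_ae_eq_zero_of_vorticity_memLp`.
(The bounds (3.8) allow the natural vorticity tail `|Ω| ≲ |y|^{−(2+ρ)}`; the `L^q` hypothesis asks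
for strictly faster decay somewhere in the integrated sense.) [cite: ChaeShvydkoy2013, §4 Thm. 4.1] -/
theorem selfSimilar_ae_eq_zero_of_farField_of_vorticity_memLp {ρ : ℝ} (hρ : 0 < ρ)
    (u : ℝ → EuclideanSpace ℝ (Fin 3) → EuclideanSpace ℝ (Fin 3))
    (p : ℝ → EuclideanSpace ℝ (Fin 3) → ℝ)
    (H : ℝ → EuclideanSpace ℝ (Fin 3) → EuclideanSpace ℝ (Fin 3) →L[ℝ] EuclideanSpace ℝ (Fin 3))
    (c : ℝ≥0) (V : EuclideanSpace ℝ (Fin 3) → EuclideanSpace ℝ (Fin 3))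
    (P : EuclideanSpace ℝ (Fin 3) → ℝ)
    (hsw : IsSuitableWeakSolutionOn (slab (EuclideanSpace ℝ (Fin 3)) (Iio 0) isOpen_Iio) 0 0 u p)
    (hH : HasWeakSpatialGradientOn (slab (EuclideanSpace ℝ (Fin 3)) (Iio 0) isOpen_Iio) u H)
    (hgauge : ∀ a : ℝ, 0 < a →
      ENNReal.ofReal (a ^ (2 * ρ)) * cknA a (0 : ℝ × EuclideanSpace ℝ (Fin 3)) u +
          ENNReal.ofReal (a ^ ρ) * cknE a (0 : ℝ × EuclideanSpace ℝ (Fin 3)) H +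
        ENNReal.ofReal (a ^ (2 * ρ)) * cknD a (0 : ℝ × EuclideanSpace ℝ (Fin 3)) p ≤ (c : ℝ≥0∞))
    (hu : ∀ τ : ℝ, τ < 0 → u τ = selfSimilarCollapse (1 / (2 + ρ)) 0 V τ)
    (hprof : IsSelfSimilarEulerProfile (1 / (2 + ρ)) 0 V P)
    {C : ℝ} (hfar : HasSelfSimilarFarFieldWith (1 / (2 + ρ)) 0 C V)
    {q : ℝ} (hq : 0 < q) (hq3 : q < 3 / (2 + ρ))
    (hΩq : MemLp (curl V) (ENNReal.ofReal q) volume) :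
    uncurry u =ᵐ[volume.restrict (Iio (0 : ℝ) ×ˢ (univ : Set (EuclideanSpace ℝ (Fin 3))))] 0 :=
  selfSimilar_ae_eq_zero_of_vorticity_memLp hρ u p H c V P hsw hH hgauge hu hprof
    (tendsto_strain_of_hasSelfSimilarFarFieldWith (by positivity) hfar) hq hq3 hΩq

/-- **The outgoing-nodal stratum (every `ρ > 0`)**: no exactly self-similar class member has a
classical profile with a vortical stagnation point of the self-similar transport field `V = γy + U`
(`V(z) = 0`, `curl U(z) ≠ 0`) at which CIV's local outgoing property (Def. 3.7) holds — by CIV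
Theorem 3.8 (tree `IsSelfSimilarEulerProfile.half_add_le_of_isLocallyOutgoing`) such a point forces
`γ ≥ ½ + c_* ≥ ½`, whereas the class exponent is `γ = 1/(2+ρ) < ½`. The hypotheses are
contradictory, so the member (indeed anything) follows; recorded as the kernel form of the route's
KILL-TEST constraint "a refuting self-similar member must be NON-outgoing".
[cite: ConstantinIgnatovaVicol2026Putative, §3.5 Thm. 3.8] -/
theorem selfSimilar_ae_eq_zero_of_outgoing_vortical_node {ρ : ℝ} (hρ : 0 < ρ)
    (u : ℝ → EuclideanSpace ℝ (Fin 3) → EuclideanSpace ℝ (Fin 3))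
    (V : EuclideanSpace ℝ (Fin 3) → EuclideanSpace ℝ (Fin 3)) (P : EuclideanSpace ℝ (Fin 3) → ℝ)
    (hprof : IsSelfSimilarEulerProfile (1 / (2 + ρ)) 0 V P)
    {κ ε : ℝ} (hout : IsLocallyOutgoing (1 / (2 + ρ)) 0 V κ ε)
    {z : EuclideanSpace ℝ (Fin 3)} (hz : z ∈ selfSimilarNodalSet (1 / (2 + ρ)) 0 V)
    (hΩ : curl V z ≠ 0) :
    uncurry u =ᵐ[volume.restrict (Iio (0 : ℝ) ×ˢ (univ : Set (EuclideanSpace ℝ (Fin 3))))] 0 := by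
  exfalso
  have h1 : 1 / 2 + κ ≤ 1 / (2 + ρ) := hprof.half_add_le_of_isLocallyOutgoing hout hz hΩ
  have h2 : 1 / (2 + ρ) < 1 / 2 := by
    rw [div_lt_div_iff_of_pos_left one_pos (by linarith) (by norm_num)]
    linarith
  linarith [hout.nonneg]

end Summit.NavierStokesRegularity.NavierStokesRegularity.Theorems.PowerGaugeEulerLiouville

end
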